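import Summits.AnomalousDissipation.AnomalousDissipation.Theorems.BaireTransferRobustLoudUpgradeLine
import Literature.Analysis.FluidPDE.LongTimeAveragePeriodic
import Literature.Analysis.FluidPDE.LerayProjectorTorusProofs
import Literature.Analysis.FunctionSpaces.TorusFourierModes
import Literature.Analysis.FunctionSpaces.TorusSpaceTime
import Literature.Analysis.FunctionSpaces.TorusFourierCalculus

/-!
# Negative knowledge for the crux `RobustLoudUpgrade` (stmt-AnomalousDissipation-1144), part 1/2:
# the Galilean-DRIFT field of the Kolmogorov force — vocabulary and calculus

Refuter (drefute of line `malkin-cone-group-orbits`, skeleton v2).  The v2 TAME classes of the line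
(`nondegSteady`, `persistSteady`, `censusSteady`, `malkinSteady` of
`Theorems/BaireTransferRobustLoudUpgradeLine.lean`) admit only MEAN-ZERO steady witnesses, and
`nondegPeriodic` excludes steady states.  This file and its sequel `GalileanDrift.lean` certify that the loud
set of the line nevertheless contains, for the gravest shear (Kolmogorov) force
`f = A sin(2πx₂) e₁ = force S (cLam S A)` and EVERY drift `m : ℝ`, an exact classical steady state with mean
`(0, m, 0)`: `u_{w,m} = Re (e_{k₀} • w v₀) + m e₂` (`driftField w m`) with `w = A/(4π²ν + 2πi m)` — the laminar
profile advected ACROSS the shear by its own mean (amplitude-reduced, phase-lagged).  Here: the shear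
vocabulary `k₀, v₀, cLam` (certified copy of `Cruxes/RobustLoudUpgrade/Disproof.lean` §6, cdisprove gen. 3,
re-vendored so that no Theorems file imports a crux work file), the force identity `force_cLam`, the drift
field as a real trigonometric polynomial on `{0, ±k₀}` (smooth, divergence free), its decomposition
`driftField_apply`, and its calculus: `∂₀u = 0`, `∂₁u = Φ_{2πi w}`, `Δu = Φ_{−4π²w}`,
`(u·∇)u = m Φ_{2πi w}` (`convect_driftField`: only the mean advects the profile).  Supports
stmt-AnomalousDissipation-1144.
-/

set_option linter.dupNamespace false

noncomputable section

namespace Summit.AnomalousDissipation.AnomalousDissipation.Theorems.RobustLoudUpgrade.Negative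

open scoped BigOperators Topology ENNReal InnerProductSpace ComplexConjugate
open Filter Set MeasureTheory
open Literature.Analysis.FunctionSpaces Literature.Analysis.FunctionSpaces.Torus
open Literature.Analysis.FluidPDE
open Summit.AnomalousDissipation.AnomalousDissipation.Theses.BaireTransfer
open UnitAddTorus EuclideanSpace

/-- The flat unit torus `T³`. -/
local notation "𝕋³" => UnitAddTorus (Fin 3)
/-- Real velocity values. -/
local notation "ℝ³" => EuclideanSpace ℝ (Fin 3)
/-- Complex Fourier coefficients. -/
local notation "ℂ³" => EuclideanSpace ℂ (Fin 3)

namespace GalileanDrift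

/-! ## §1 Shear vocabulary (certified copy of Disproof §6) -/

/-- The gravest shear frequency `k₀ = (0,1,0)`. [folklore] -/
def k₀ : Fin 3 → ℤ := Pi.single 1 1

/-- The polarisation `v₀ = (−i, 0, 0) ⊥ k₀` (so that `Re (e_{k₀} • v₀) = sin(2πx₂) e₁`). [folklore] -/
def v₀ : ℂ³ := WithLp.toLp 2 (Pi.single 0 (-Complex.I))

/-- Coordinates of `k₀`. [folklore] -/
theorem k₀_apply (i : Fin 3) : k₀ i = if i = 1 then 1 else 0 := by
  simp [k₀, Pi.single_apply]

/-- Coordinates of `v₀`. [folklore] -/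
theorem v₀_apply (i : Fin 3) : v₀ i = if i = 0 then -Complex.I else 0 := by
  simp [v₀]

/-- `k₀ ≠ 0`. [folklore] -/
theorem k₀_ne_zero : k₀ ≠ 0 := by
  intro h; have := congrFun h 1; simp [k₀] at this

/-- `−k₀ ≠ k₀`. [folklore] -/
theorem neg_k₀_ne : -k₀ ≠ k₀ := by
  intro h; have := congrFun h 1; simp [k₀] at this

/-- `−k₀ ≠ 0`. [folklore] -/
theorem neg_k₀_ne_zero : -k₀ ≠ 0 := neg_ne_zero.2 k₀_ne_zero

/-- `|k₀|² = 1`. [folklore] -/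
theorem freqNormSq_k₀ : freqNormSq k₀ = 1 := by
  simp [freqNormSq, k₀_apply]

/-- `‖v₀‖ = 1`. [folklore] -/
theorem norm_v₀ : ‖v₀‖ = 1 := by
  rw [EuclideanSpace.norm_eq]
  simp [v₀_apply, Fin.sum_univ_three]

variable {S : Finset (Fin 3 → ℤ)}

/-- The laminar coefficient vector of amplitude `A` in any `P_S` with `k₀ ∈ S` (`f_{cLam A} = A sin(2πx₂) e₁`). [folklore] -/
def cLam (S : Finset (Fin 3 → ℤ)) (A : ℝ) : Coeff S :=
  fun k => if (k : Fin 3 → ℤ) = k₀ then (A : ℂ) • v₀ else 0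

/-- The Leray multiplier fixes the transversal polarisation `A v₀` at `k₀`. -/
theorem lerayCoeff_k₀ (A : ℝ) : Torus.lerayCoeff k₀ ((A : ℂ) • v₀) = (A : ℂ) • v₀ := by
  rw [Torus.lerayCoeff, if_neg k₀_ne_zero]
  have : ∑ i, (k₀ i : ℂ) * (((A : ℂ) • v₀) i) = 0 := by
    simp [k₀_apply, v₀_apply]
  rw [this, zero_div, zero_smul, sub_zero]

/-- The Leray multiplier kills the zero vector at every frequency. [folklore] -/
theorem lerayCoeff_zero_vec (k : Fin 3 → ℤ) : Torus.lerayCoeff k (0 : ℂ³) = 0 := by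
  by_cases hk : k = 0
  · subst hk; simp
  · rw [Torus.lerayCoeff, if_neg hk]; simp

/-- The force coefficients of `cLam A`: `A v₀` at `k₀`, zero elsewhere. -/
theorem forceCoeff_cLam (hS : k₀ ∈ S) (A : ℝ) (k : Fin 3 → ℤ) :
    Torus.lerayCoeff k (coeffExt S (cLam S A) k) = if k = k₀ then (A : ℂ) • v₀ else 0 := by
  by_cases hk : k = k₀
  · subst hk
    rw [if_pos rfl, coeffExt_of_mem _ hS]
    have : cLam S A ⟨k₀, hS⟩ = (A : ℂ) • v₀ := by simp [cLam]
    rw [this, lerayCoeff_k₀]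
  · rw [if_neg hk]
    have hz : coeffExt S (cLam S A) k = 0 := by
      by_cases hkS : k ∈ S
      · rw [coeffExt_of_mem _ hkS]; simp [cLam, hk]
      · exact coeffExt_of_not_mem _ hkS
    rw [hz, lerayCoeff_zero_vec]

/-- The elementary shear-polarised field `Φ_w(x) = Re (e_{k₀}(x) • w v₀)` (`w ∈ ℂ`): for `w = A` real it is
`A sin(2πx₂) e₁`, for general `w = α + iβ` it is `(α sin + β cos)(2πx₂) e₁`. [folklore] -/
def Φ (w : ℂ) (x : 𝕋³) : ℝ³ := realPart (mFourier k₀ x • (w • v₀))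

/-- `Φ` is additive in the complex amplitude. [folklore] -/
theorem Φ_add (w w' : ℂ) (x : 𝕋³) : Φ (w + w') x = Φ w x + Φ w' x := by
  simp only [Φ, add_smul, smul_add, map_add]

/-- `Φ` is real-homogeneous in the complex amplitude. [folklore] -/
theorem Φ_real_smul (r : ℝ) (w : ℂ) (x : 𝕋³) : Φ ((r : ℂ) * w) x = r • Φ w x := by
  simp only [Φ]
  rw [mul_smul, smul_comm (mFourier k₀ x) (r : ℂ) (w • v₀), Complex.coe_smul, map_smul]

/-- **`f_{cLam A} = Φ_A`**: the designer force of the laminar coefficient vector is the shear force. -/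
theorem force_cLam (hS : k₀ ∈ S) (A : ℝ) (x : 𝕋³) : force S (cLam S A) x = Φ (A : ℂ) x := by
  rw [force, realTrigPoly_apply, trigPoly_apply,
    Finset.sum_eq_single_of_mem k₀ hS fun k _ hk => by rw [forceCoeff_cLam hS, if_neg hk, smul_zero],
    forceCoeff_cLam hS, if_pos rfl]
  rfl

/-! ## §2 The drift field as a real trigonometric polynomial on `T₁ = {0, k₀, −k₀}` -/

/-- The symmetric support `{0, k₀, −k₀}`. [folklore] -/
def T₁ : Finset (Fin 3 → ℤ) := insert 0 {k₀, -k₀}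

/-- `T₁` is symmetric under `k ↦ −k`. [folklore] -/
theorem T₁_symm : ∀ k ∈ T₁, -k ∈ T₁ := by
  intro k hk
  simp only [T₁, Finset.mem_insert, Finset.mem_singleton] at hk ⊢
  rcases hk with rfl | rfl | rfl
  · exact Or.inl neg_zero
  · exact Or.inr (Or.inr rfl)
  · exact Or.inr (Or.inl (neg_neg _))

/-- The constant mode `m e₂` (complex coefficients). [folklore] -/
def mC (m : ℝ) : ℂ³ := EuclideanSpace.single 1 (m : ℂ)

/-- Coefficient family of the drift field: `m e₂` at `0`, `(w/2) v₀` at `k₀`, its conjugate at `−k₀`. [folklore] -/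
def W (w : ℂ) (m : ℝ) : (Fin 3 → ℤ) → ℂ³ := fun k =>
  if k = 0 then mC m else if k = k₀ then (w / 2) • v₀ else if k = -k₀ then (conj w / 2) • conjVec v₀ else 0

/-- The zero mode of `W` is the constant `m e₂`. [folklore] -/
theorem W_zero (w : ℂ) (m : ℝ) : W w m 0 = mC m := by simp [W]

/-- The `k₀` mode of `W`. [folklore] -/
theorem W_k₀ (w : ℂ) (m : ℝ) : W w m k₀ = (w / 2) • v₀ := by simp [W, k₀_ne_zero]

/-- The `−k₀` mode of `W` (conjugate of the `k₀` mode). [folklore] -/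
theorem W_neg_k₀ (w : ℂ) (m : ℝ) : W w m (-k₀) = (conj w / 2) • conjVec v₀ := by
  simp [W, k₀_ne_zero, neg_k₀_ne]

/-- `W` vanishes off `T₁`. [folklore] -/
theorem W_of_ne {w : ℂ} {m : ℝ} {k : Fin 3 → ℤ} (h0 : k ≠ 0) (h1 : k ≠ k₀) (h2 : k ≠ -k₀) :
    W w m k = 0 := by simp [W, h0, h1, h2]

/-- The constant mode is real (conjugation invariant). [folklore] -/
theorem conjVec_mC (m : ℝ) : conjVec (mC m) = mC m := by
  ext i; simp [mC, conjVec_apply]; split_ifs <;> simp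

/-- `W` is conjugate symmetric (reality of the drift field). [folklore] -/
theorem isConjSymm_W (w : ℂ) (m : ℝ) : IsConjSymm (W w m) := by
  intro k
  by_cases h0 : k = 0
  · subst h0; rw [neg_zero, W_zero, conjVec_mC]
  by_cases h1 : k = k₀
  · subst h1
    rw [W_neg_k₀, W_k₀, conjVec_smul, map_div₀, Complex.conj_ofNat]
  by_cases h2 : k = -k₀
  · subst h2
    rw [neg_neg, W_k₀, W_neg_k₀, conjVec_smul, conjVec_conjVec, map_div₀, Complex.conj_conj,
      Complex.conj_ofNat]
  · have h0' : -k ≠ 0 := neg_ne_zero.2 h0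
    have h1' : -k ≠ k₀ := fun h => h2 (by rw [← h, neg_neg])
    have h2' : -k ≠ -k₀ := fun h => h1 (neg_injective h)
    rw [W_of_ne h0' h1' h2', W_of_ne h0 h1 h2, conjVec_zero]

/-- `W` is transversal (`k · W k = 0`): the drift field is divergence free. [folklore] -/
theorem isTransversal_W (w : ℂ) (m : ℝ) : IsTransversal T₁ (W w m) := by
  intro k hk
  simp only [T₁, Finset.mem_insert, Finset.mem_singleton] at hk
  rcases hk with rfl | rfl | rfl
  · simp
  · simp [W_k₀, k₀_apply, v₀_apply]
  · simp [W_neg_k₀, k₀_apply, v₀_apply, conjVec_apply]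

/-- **The drift field** `u_{w,m} = Re (e_{k₀} • w v₀) + m e₂` as a real trigonometric polynomial. [folklore] -/
def driftField (w : ℂ) (m : ℝ) : 𝕋³ → ℝ³ := realTrigPoly T₁ (W w m)

/-- The drift field is smooth. [folklore] -/
theorem isSmooth_driftField (w : ℂ) (m : ℝ) : IsSmooth (driftField w m) := isSmooth_realTrigPoly _ _

/-- The drift field is divergence free. [folklore] -/
theorem isDivFree_driftField (w : ℂ) (m : ℝ) : IsDivFree (driftField w m) :=
  isDivFree_realTrigPoly (isTransversal_W w m)

/-- The real constant vector `m e₂`. [folklore] -/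
def mR (m : ℝ) : ℝ³ := EuclideanSpace.single 1 m

/-- The real part of the constant mode is `m e₂`. [folklore] -/
theorem realPart_mC (m : ℝ) : realPart (mC m) = mR m := by
  ext i; simp [mC, mR]; split_ifs <;> simp

/-- `0 ∉ {k₀, −k₀}`. [folklore] -/
theorem zero_not_mem_T₀ : (0 : Fin 3 → ℤ) ∉ ({k₀, -k₀} : Finset (Fin 3 → ℤ)) := by
  simp [k₀_ne_zero.symm, neg_k₀_ne_zero.symm]

/-- `k₀ ∉ {−k₀}`. [folklore] -/
theorem k₀_not_mem : k₀ ∉ ({-k₀} : Finset (Fin 3 → ℤ)) := by simp [neg_k₀_ne.symm]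

/-- **Pointwise decomposition**: `driftField w m x = Φ_w(x) + m e₂`. -/
theorem driftField_apply (w : ℂ) (m : ℝ) (x : 𝕋³) : driftField w m x = Φ w x + mR m := by
  rw [driftField, realTrigPoly_apply, trigPoly_apply, T₁, Finset.sum_insert zero_not_mem_T₀,
    Finset.sum_insert k₀_not_mem, Finset.sum_singleton, W_zero, W_k₀, W_neg_k₀, map_add, map_add]
  have h0 : realPart (mFourier (0 : Fin 3 → ℤ) x • mC m) = mR m := by
    rw [show mFourier (0 : Fin 3 → ℤ) x = 1 from by simp [UnitAddTorus.mFourier_zero], one_smul,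
      realPart_mC]
  have hconj : mFourier (-k₀) x • ((conj w / 2) • conjVec v₀) = conjVec (mFourier k₀ x • ((w / 2) • v₀)) := by
    rw [conjVec_smul, conjVec_smul, mFourier_neg, map_div₀, Complex.conj_ofNat]
  rw [h0, hconj, realPart_conjVec, add_comm (mR m)]
  congr 1
  rw [← two_smul ℝ (realPart (mFourier k₀ x • ((w / 2) • v₀))), ← map_smul, Φ]
  congr 1
  rw [smul_comm (2 : ℝ) (mFourier k₀ x)]
  congr 1
  rw [← Complex.coe_smul, smul_smul]
  congr 1
  push_cast; ring


/-! ## §3 Calculus of the drift field -/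

/-- `mC 0 = 0`. [folklore] -/
theorem mC_zero : mC 0 = 0 := by
  simp [mC]

/-- `mR 0 = 0`. [folklore] -/
theorem mR_zero : mR 0 = 0 := by
  simp [mR]

/-- The drift field does not depend on `x₁`: `∂₀ u = 0`. -/
theorem partialDeriv_zero_driftField (w : ℂ) (m : ℝ) (x : 𝕋³) : partialDeriv 0 (driftField w m) x = 0 := by
  rw [driftField, partialDeriv_realTrigPoly]
  have h : realTrigPoly T₁ (fun k => (2 * Real.pi * Complex.I * (k (0 : Fin 3) : ℂ)) • W w m k) =
      realTrigPoly T₁ 0 := by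
    refine realTrigPoly_congr fun k hk => ?_
    simp only [T₁, Finset.mem_insert, Finset.mem_singleton] at hk
    rcases hk with rfl | rfl | rfl <;> simp [k₀_apply]
  rw [h, realTrigPoly_zero]
  rfl

/-- `∂₁ u_{w,m} = Φ_{2πi w}` (the cross-stream derivative of the shear profile). -/
theorem partialDeriv_one_driftField (w : ℂ) (m : ℝ) (x : 𝕋³) :
    partialDeriv 1 (driftField w m) x = Φ (2 * Real.pi * Complex.I * w) x := by
  rw [driftField, partialDeriv_realTrigPoly]
  have h : realTrigPoly T₁ (fun k => (2 * Real.pi * Complex.I * (k (1 : Fin 3) : ℂ)) • W w m k) =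
      realTrigPoly T₁ (W (2 * Real.pi * Complex.I * w) 0) := by
    refine realTrigPoly_congr fun k hk => ?_
    simp only [T₁, Finset.mem_insert, Finset.mem_singleton] at hk
    rcases hk with rfl | rfl | rfl
    · simp [W_zero, mC_zero]
    · rw [W_k₀, W_k₀, smul_smul, k₀_apply]; congr 1; push_cast; ring
    · rw [W_neg_k₀, W_neg_k₀, smul_smul, Pi.neg_apply, k₀_apply]; congr 1
      simp only [if_true, map_mul, Complex.conj_ofReal, Complex.conj_I, Complex.conj_ofNat]
      push_cast; ring
  rw [h]
  change driftField (2 * Real.pi * Complex.I * w) 0 x = _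
  rw [driftField_apply, mR_zero, add_zero]

/-- `Δ u_{w,m} = Φ_{−4π² w}` (the constant mode is harmonic, the shear modes are Stokes eigenfields). -/
theorem laplacian_driftField (w : ℂ) (m : ℝ) (x : 𝕋³) :
    laplacian (driftField w m) x = Φ (-(4 * Real.pi ^ 2) * w) x := by
  rw [driftField, laplacian_realTrigPoly]
  have h : realTrigPoly T₁ (fun k => -(((4 * Real.pi ^ 2 * freqNormSq k : ℝ) : ℂ) • W w m k)) =
      realTrigPoly T₁ (W (-(4 * Real.pi ^ 2) * w) 0) := by
    refine realTrigPoly_congr fun k hk => ?_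
    simp only [T₁, Finset.mem_insert, Finset.mem_singleton] at hk
    rcases hk with rfl | rfl | rfl
    · simp [W_zero, mC_zero, freqNormSq_zero]
    · rw [W_k₀, W_k₀, freqNormSq_k₀, smul_smul, ← neg_smul]; congr 1; push_cast; ring
    · rw [W_neg_k₀, W_neg_k₀, freqNormSq_neg, freqNormSq_k₀, smul_smul, ← neg_smul]; congr 1
      simp only [map_mul, map_neg, Complex.conj_ofReal, map_pow, Complex.conj_ofNat]
      push_cast; ring
  rw [h]
  change driftField (-(4 * Real.pi ^ 2) * w) 0 x = _
  rw [driftField_apply, mR_zero, add_zero]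

/-- The shear-polarised field is parallel to `e₁`. -/
theorem Φ_apply_of_ne (w : ℂ) (x : 𝕋³) {i : Fin 3} (hi : i ≠ 0) : Φ w x i = 0 := by
  simp [Φ, v₀_apply, hi]

/-- Value decomposition `u(x) = u(x)₀ e₁ + m e₂` (no `e₃` component). -/
theorem driftField_eq_basis (w : ℂ) (m : ℝ) (x : 𝕋³) :
    driftField w m x = (driftField w m x 0) • EuclideanSpace.single (0 : Fin 3) (1 : ℝ) +
      m • EuclideanSpace.single (1 : Fin 3) (1 : ℝ) := by
  ext i
  rw [driftField_apply]
  fin_cases i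
  · simp [mR]
  · simp [mR, Φ_apply_of_ne]
  · simp [mR, Φ_apply_of_ne]

/-- **Self-advection of the drift field**: `(u·∇)u = m ∂₁u = m Φ_{2πi w}` — only the mean advects
the profile, across the shear. -/
theorem convect_driftField (w : ℂ) (m : ℝ) (x : 𝕋³) :
    Torus.convect (driftField w m) (driftField w m) x = m • Φ (2 * Real.pi * Complex.I * w) x := by
  have hC : IsContDiff 1 (driftField w m) := (isSmooth_driftField w m).isContDiff (by simp)
  unfold Torus.convect
  rw [driftField_eq_basis w m x, map_add, map_smul, map_smul, ← partialDeriv_eq_fderiv_apply hC,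
    ← partialDeriv_eq_fderiv_apply hC, partialDeriv_zero_driftField, smul_zero, zero_add,
    partialDeriv_one_driftField]


/-! ## §4 The drift amplitude and the steady momentum balance -/

/-- The complex denominator `4π²ν + 2πi m` of the drifted Stokes balance. [folklore] -/
def den (ν m : ℝ) : ℂ := ((4 * Real.pi ^ 2 * ν : ℝ) : ℂ) + ((2 * Real.pi * m : ℝ) : ℂ) * Complex.I

/-- Real part of the denominator: `4π²ν`. [folklore] -/
theorem den_re (ν m : ℝ) : (den ν m).re = 4 * Real.pi ^ 2 * ν := by
  simp only [den, Complex.add_re, Complex.ofReal_re, Complex.mul_re, Complex.ofReal_im, Complex.I_re,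
    Complex.I_im, mul_zero, zero_mul, sub_zero, add_zero]

/-- Imaginary part of the denominator: `2πm`. [folklore] -/
theorem den_im (ν m : ℝ) : (den ν m).im = 2 * Real.pi * m := by
  simp only [den, Complex.add_im, Complex.ofReal_im, Complex.mul_im, Complex.ofReal_re, Complex.I_re,
    Complex.I_im, mul_zero, mul_one, zero_add, add_zero]

/-- The denominator does not vanish for `ν ≠ 0`. [folklore] -/
theorem den_ne_zero {ν : ℝ} (hν : ν ≠ 0) (m : ℝ) : den ν m ≠ 0 := by
  intro h
  have := congrArg Complex.re h
  rw [den_re, Complex.zero_re] at this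
  have hπ : Real.pi ≠ 0 := Real.pi_ne_zero
  exact hν (by
    have h4 : (4 * Real.pi ^ 2) ≠ 0 := by positivity
    exact (mul_eq_zero.1 this).resolve_left h4)

/-- **The drift amplitude** `z = A / (4π²ν + 2πi m)` (`= α + iβ`, `α = Aν/(4π²ν² + m²)`,
`β = −mα/(2πν)`): amplitude-reduced and phase-lagged laminar response advected by the mean `m e₂`. [folklore] -/
def zOf (ν A m : ℝ) : ℂ := (A : ℂ) / den ν m

/-- The coefficient identity behind the momentum balance: `m · 2πi z = ν · (−4π²) z + A`. -/
theorem zOf_balance {ν : ℝ} (hν : ν ≠ 0) (A m : ℝ) :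
    (m : ℂ) * (2 * Real.pi * Complex.I * zOf ν A m) = (ν : ℂ) * (-(4 * Real.pi ^ 2) * zOf ν A m) + A := by
  have hden := den_ne_zero hν m
  have hz : zOf ν A m * den ν m = A := div_mul_cancel₀ _ hden
  rw [den] at hz
  push_cast at hz
  linear_combination hz

/-- `|z|² = A² / (16π⁴ν² + 4π²m²)`. -/
theorem norm_sq_zOf (ν A m : ℝ) :
    ‖zOf ν A m‖ ^ 2 = A ^ 2 / (16 * Real.pi ^ 4 * ν ^ 2 + 4 * Real.pi ^ 2 * m ^ 2) := by
  rw [zOf, norm_div, div_pow, Complex.norm_real, Real.norm_eq_abs, sq_abs, Complex.sq_norm,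
    Complex.normSq_apply, den_re, den_im]
  congr 1
  ring

/-- **The drift field is a classical steady state** of NS_ν forced by `f_{cLam A}`, pressure `0`, for
EVERY drift `m` (and every `ν ≠ 0`, `A`). -/
theorem driftField_isClassical (hS : k₀ ∈ S) {ν : ℝ} (hν : ν ≠ 0) (A m : ℝ) :
    IsClassicalNSSolutionOn Set.univ ν (fun _ => force S (cLam S A))
      (fun _ => driftField (zOf ν A m) m) (fun _ _ => 0) where
  smooth_velocity := isSmoothSpaceTimeOn_const (isSmooth_driftField _ _) _
  smooth_pressure := isSmoothSpaceTimeOn_const (isSmooth_const _) _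
  momentum := fun t _ x => by
    have h0 : Torus.timeDerivWithin Set.univ (fun _ : ℝ => driftField (zOf ν A m) m) t x = 0 := by
      simp [Torus.timeDerivWithin]
    have hg : Torus.gradient (fun _ : 𝕋³ => (0 : ℝ)) x = 0 := by
      have : liftAt (fun _ : 𝕋³ => (0 : ℝ)) x = fun _ => 0 := rfl
      rw [Torus.gradient, this]
      exact gradient_fun_const 0 0
    rw [h0, zero_add, convect_driftField, laplacian_driftField, hg, sub_zero, force_cLam hS,
      ← Φ_real_smul, ← Φ_real_smul, ← Φ_add, zOf_balance hν]
  divFree := fun _ _ => isDivFree_driftField _ _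

/-! ## §5 Budgets and mean of the drift field -/

/-- `‖m e₂‖ = |m|`. [folklore] -/
theorem norm_mC (m : ℝ) : ‖mC m‖ = |m| := by
  rw [mC, EuclideanSpace.norm_eq]
  simp [Fin.sum_univ_three, Real.sqrt_sq_eq_abs]

/-- `‖u_{w,m}‖₂² = m² + |w|²/2`. -/
theorem integral_norm_sq_driftField (w : ℂ) (m : ℝ) :
    ∫ x, ‖driftField w m x‖ ^ 2 = m ^ 2 + ‖w‖ ^ 2 / 2 := by
  rw [driftField, integral_norm_sq_realTrigPoly T₁_symm (isConjSymm_W w m), T₁,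
    Finset.sum_insert zero_not_mem_T₀, Finset.sum_insert k₀_not_mem, Finset.sum_singleton, W_zero, W_k₀,
    W_neg_k₀, norm_mC, norm_smul, norm_smul, norm_conjVec, norm_v₀, norm_div, norm_div,
    Complex.norm_conj, sq_abs]
  norm_num
  ring

/-- `‖∇u_{w,m}‖₂² = 2π²|w|²` (spectral; the mean carries no gradient). -/
theorem eGradNormSq_driftField (w : ℂ) (m : ℝ) :
    eGradNormSq (driftField w m) = ENNReal.ofReal (2 * Real.pi ^ 2 * ‖w‖ ^ 2) := by
  rw [driftField, eGradNormSq_realTrigPoly T₁_symm (isConjSymm_W w m)]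
  congr 1
  rw [T₁, Finset.sum_insert zero_not_mem_T₀, Finset.sum_insert k₀_not_mem, Finset.sum_singleton, W_k₀,
    W_neg_k₀, norm_smul, norm_smul, norm_conjVec, norm_v₀, norm_div, norm_div, Complex.norm_conj,
    freqNormSq_zero, freqNormSq_neg, freqNormSq_k₀]
  norm_num
  ring

/-- Mean energy of the steady drift state: `⟨‖u‖₂²⟩ = m² + |w|²/2`. -/
theorem meanEnergy_driftField (w : ℂ) (m : ℝ) :
    meanEnergy (fun _ : ℝ => driftField w m) = m ^ 2 + ‖w‖ ^ 2 / 2 := by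
  rw [meanEnergy_eq_of_periodic (τ := 1) (fun _ => rfl) one_pos]
  simp [integral_norm_sq_driftField]

/-- Mean dissipation of the steady drift state: `ν⟨‖∇u‖₂²⟩ = 2π²ν |w|²`. -/
theorem meanDissipation_driftField (ν : ℝ) (w : ℂ) (m : ℝ) :
    meanDissipation ν (fun _ : ℝ => driftField w m) = ν * (2 * Real.pi ^ 2 * ‖w‖ ^ 2) := by
  rw [meanDissipation_eq_of_periodic (τ := 1) (fun _ => rfl) one_pos]
  simp [eGradNormSq_driftField, ENNReal.toReal_ofReal (by positivity : (0 : ℝ) ≤ 2 * Real.pi ^ 2 * ‖w‖ ^ 2)]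

/-- **The mean of the drift field is `m e₂`** (NOT zero for `m ≠ 0`). -/
theorem integral_driftField (w : ℂ) (m : ℝ) : ∫ x, driftField w m x = mR m := by
  rw [driftField]
  simp only [realTrigPoly_apply]
  have hint : Integrable (trigPoly T₁ (W w m)) volume := (continuous_trigPoly T₁ _).integrable_unitAddTorus
  rw [ContinuousLinearMap.integral_comp_comm _ hint]
  have h0 : ∫ x, trigPoly T₁ (W w m) x = mC m := by
    simp only [trigPoly_apply]
    rw [integral_finsetSum T₁ (f := fun k x => UnitAddTorus.mFourier k x • W w m k) fun k _ =>
      ((UnitAddTorus.mFourier k).continuous.smul continuous_const).integrable_unitAddTorus]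
    rw [T₁, Finset.sum_insert zero_not_mem_T₀, Finset.sum_eq_zero fun k hk => ?_]
    · rw [integral_smul_const, integral_mFourier, if_pos rfl, one_smul, W_zero, add_zero]
    · simp only [Finset.mem_insert, Finset.mem_singleton] at hk
      rw [integral_smul_const, integral_mFourier, if_neg (by rcases hk with rfl | rfl <;> simp [k₀_ne_zero]),
        zero_smul]
  rw [h0, realPart_mC]

/-- Hence the drift field is NOT mean zero unless `m = 0`. -/
theorem not_hasZeroMean_driftField (w : ℂ) {m : ℝ} (hm : m ≠ 0) : ¬ HasZeroMean (driftField w m) := by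
  intro h
  rw [HasZeroMean, integral_driftField] at h
  have := congrArg (fun v : ℝ³ => v 1) h
  simp [mR] at this
  exact hm this

/-! ## §6 The loud set contains the drifting states: nonzero-mean loud witnesses at every Grashof number -/

/-- **`cLam A ∈ LOUD^{(0,a)}(S, m² + |z|²/2, 2π²ν|z|²)`** for every `S ∋ k₀`, every amplitude `A`, every
ceiling `a`, every `ν ∈ (0,a)` and EVERY drift `m` — witnessed by the steady drift state of mean `m e₂`
(`z = zOf ν A m`, `|z|² = A²/(16π⁴ν² + 4π²m²)`, `norm_sq_zOf`).  At `m = 0` this is the laminar witness of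
Disproof §6; for `m ≠ 0` the witness is invisible to every mean-zero steady class of the line. -/
theorem cLam_mem_loud_drift (hS : k₀ ∈ S) {A a ν : ℝ} (hν : 0 < ν) (hνa : ν < a) (m : ℝ) :
    cLam S A ∈ loud S a (m ^ 2 + ‖zOf ν A m‖ ^ 2 / 2) (ν * (2 * Real.pi ^ 2 * ‖zOf ν A m‖ ^ 2)) :=
  ⟨ν, hν, hνa, 1, _, _, one_pos, driftField_isClassical hS hν.ne' A m, fun _ => rfl,
    (meanEnergy_driftField _ _).le, (meanDissipation_driftField _ _ _).ge⟩


/-- The same membership with the budgets written out in `(A, ν, m)`: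
`E = m² + A²/(2(16π⁴ν² + 4π²m²))`, `ε = 2π²ν A²/(16π⁴ν² + 4π²m²)` — i.e. `E = m² + E_lam/(1+ρ)`,
`ε = ε_lam/(1+ρ)` with `ρ = m²/(4π²ν²)`, `E_lam = A²/(32π⁴ν²)`, `ε_lam = A²/(8π²ν)` (Disproof §6). -/
theorem cLam_mem_loud_drift' (hS : k₀ ∈ S) {A a ν : ℝ} (hν : 0 < ν) (hνa : ν < a) (m : ℝ) :
    cLam S A ∈ loud S a (m ^ 2 + A ^ 2 / (16 * Real.pi ^ 4 * ν ^ 2 + 4 * Real.pi ^ 2 * m ^ 2) / 2)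
      (ν * (2 * Real.pi ^ 2 * (A ^ 2 / (16 * Real.pi ^ 4 * ν ^ 2 + 4 * Real.pi ^ 2 * m ^ 2)))) := by
  have h := cLam_mem_loud_drift hS (A := A) hν hνa m
  rwa [norm_sq_zOf] at h

end GalileanDrift

end Summit.AnomalousDissipation.AnomalousDissipation.Theorems.RobustLoudUpgrade.Negative

end
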